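import Literature.NumberTheory.GaloisRepresentations.ContinuousRep
import Literature.NumberTheory.GaloisRepresentations.ResidualRepresentation
import Mathlib.Analysis.Normed.Field.Basic
import Mathlib.Analysis.Normed.Group.Ultra
import Mathlib.NumberTheory.Padics.Complex
import HarnessLib

/-!
# Residual congruence and absolutely irreducible reduction (Burnside form)

Residual-side vocabulary for framed representations `ρ : Γ →ₜ* GL_n(K)` (`FramedRep`) with
coefficients in a normed field `K` — intended non-archimedean, foremost `K = ℚ̄_p = PadicAlgCl p`
(Mathlib) with its `p`-adic norm, where no residue map is at hand but the valuation ring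
`O = {‖x‖ ≤ 1}` and its maximal ideal `𝔪 = {‖x‖ < 1}` are visible through the norm.  Both notions
use `‖·‖` only (no choice of lattice) and are PROVED equivalent to the usual statements about
reductions of integral models (`ResidualRepresentation.lean`).

* `FramedRep.IsResiduallyCongruent ρ ρ₀` — `‖cᵢ(ρ σ) - cᵢ(ρ₀ σ)‖ < 1` for all `σ` and all
  coefficients `cᵢ` of the characteristic polynomials.  API: `refl/symm/trans` (transitivity over
  an ultrametric `K`), invariance under change of frame, and
  `isResiduallyCongruent_iff_charpoly_residualRep_eq`: for integral models `ρ₁, ρ₂` of `ρ, ρ₀`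
  over `O = {‖x‖ ≤ 1}` it says `charpoly (ρ̄₁ σ) = charpoly (ρ̄₂ σ)` for all `σ` (hence
  `ρ̄₁ˢˢ ≅ ρ̄₂ˢˢ` by Brauer–Nesbitt, not in the tree). (Serre 1968, I.1.1, I.2.3.)
* `FramedRep.HasAbsolutelyIrreducibleReduction ρ` — BURNSIDE FORM: a frame `g` with `g ρ g⁻¹`
  entrywise of norm `≤ 1` and `n²` elements `s a ∈ Γ` such that the `n² × n²` matrix of entries
  of the `g ρ(s a) g⁻¹` has determinant of norm `1`.  API: invariance under change of frame and
  `hasAbsolutelyIrreducibleReduction_iff_exists_span_eq_top`: equivalent to the existence of an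
  integral model `ρ₀ : Γ → GL_n(O)` whose reduction `ρ̄₀ : Γ → GL_n(κ)` has image spanning
  `M_n(κ)` — for `n ≥ 1`, Burnside's criterion for absolute irreducibility of `ρ̄₀`
  (Curtis–Reiner (27.4); the tree's `Literature.NumberTheory.Automorphic.ActsIrreducibly.eq_top`).
* glue: `mem_maximalIdeal_iff_norm_lt_one`, `norm_det_map_subtype_eq_one_iff`,
  `padicAlgCl_mem_valuationSubring_iff` (for `ℚ̄_p`, `O = Valued.v.valuationSubring` is the
  closed unit ball), `isUnit_of_entries_iff_span_eq_top`.

For `K = PadicAlgCl p` both definitions are verbatim (`Iff.rfl`) the clauses inlined in route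
`Summits/Langlands/Langlands/Theses/GSpinRung` (seed congruence; big residual image, which for
`p ≥ 2(n+1)` feeds Thorne's adequacy, Thorne 2012 §2).

Mathlib has `PadicAlgCl`, `ValuationSubring`, `IsLocalRing.residue`, `Matrix.charpoly`,
`Matrix.vecMul_surjective_iff_isUnit`, `exists_linearIndependent'`, but no residual
representations, congruences of representations or Burnside-type predicate (`lean search`
`ResiduallyCongruent|AbsolutelyIrreducibleReduction|Burnside`: Literature only).  Design: any
`NormedField K`; bridge lemmas take `O : ValuationSubring K` with `hO : ∀ x, x ∈ O ↔ ‖x‖ ≤ 1`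
(applies to `ℚ̄_p`, `ℚ_p`, finite extensions alike).  Not here: independence of the lattice /
Brauer–Nesbitt; "absolutely irreducible ⟹ adequate".

## References

* J.-P. Serre, *Abelian ℓ-adic representations and elliptic curves* (1968), Ch. I §1.1, §2.3.
* C. W. Curtis, I. Reiner, *Representation theory of finite groups and associative algebras*
  (1962), (27.4) (Burnside's theorem).
* J. Thorne, *On the automorphy of `l`-adic Galois representations with small residual image*,
  J. Inst. Math. Jussieu 11 (2012), §2.
-/

noncomputable section

open scoped MatrixGroups

open Matrix IsLocalRing

namespace Literature.NumberTheory.GaloisRepresentations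

namespace FramedRep

section Defs

variable {Γ : Type*} [Group Γ] [TopologicalSpace Γ] {K : Type*} [NormedField K] {n : ℕ}

/-- **Residual congruence** of two framed representations `ρ, ρ₀ : Γ → GL_n(K)` over a normed
field `K` (intended: non-archimedean, e.g. `K = ℚ̄_p = PadicAlgCl p` with its `p`-adic norm, where
`{‖x‖ ≤ 1}` is the valuation ring and `{‖x‖ < 1}` its maximal ideal): for every `σ ∈ Γ` the
characteristic polynomials of `ρ σ` and `ρ₀ σ` are coefficientwise congruent modulo the maximal
ideal, `‖cᵢ(ρ σ) - cᵢ(ρ₀ σ)‖ < 1` for all `i`.  When `ρ, ρ₀` have integral models `ρ₁, ρ₂` (always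
the case for compact `Γ`, `exists_integralModel`), this says exactly that the reductions
`ρ̄₁, ρ̄₂ : Γ → GL_n(κ)` have the same characteristic polynomials
(`isResiduallyCongruent_iff_charpoly_residualRep_eq`), i.e. — by the Brauer–Nesbitt theorem —
that `ρ̄₁ˢˢ ≅ ρ̄₂ˢˢ` ("`ρ ≡ ρ₀ mod p`"). (Serre, *Abelian ℓ-adic representations*, I.1.1 and
I.2.3.) [folklore] -/
def IsResiduallyCongruent (ρ ρ₀ : FramedRep Γ K n) : Prop :=
  ∀ (σ : Γ) (i : ℕ), ‖((ρ σ : GL (Fin n) K) : Matrix (Fin n) (Fin n) K).charpoly.coeff i -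
      ((ρ₀ σ : GL (Fin n) K) : Matrix (Fin n) (Fin n) K).charpoly.coeff i‖ < 1

/-- **Absolutely irreducible reduction, Burnside form.** A framed representation
`ρ : Γ → GL_n(K)` over a normed field `K` (intended: non-archimedean, `K = ℚ̄_p = PadicAlgCl p`)
*has absolutely irreducible reduction* if there are a frame `g ∈ GL_n(K)` in which `ρ` is
integral (`‖(g ρ(σ) g⁻¹)ᵢⱼ‖ ≤ 1` for all `σ, i, j`) and `n²` elements `s a ∈ Γ`, `a ∈ n × n`, such
that the `n² × n²` matrix whose `a`-th row is the matrix `g ρ(s a) g⁻¹` written out as a vector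
has unit determinant, `‖det‖ = 1`: equivalently (`hasAbsolutelyIrreducibleReduction_iff_exists_span_eq_top`)
`ρ` has an integral model `ρ₀ : Γ → GL_n(O)`, `O = {‖x‖ ≤ 1}`, whose reduction
`ρ̄₀ : Γ → GL_n(κ)` modulo the maximal ideal has image spanning `M_n(κ)` — which, for `n ≥ 1`,
is Burnside's criterion for the absolute irreducibility of `ρ̄₀` (Curtis–Reiner (27.4);
`Literature.NumberTheory.Automorphic.ActsIrreducibly.eq_top`).  This phrasing needs no residue
map on `K` and is *verbatim* (`Iff.rfl`) the clause inlined in route `GSpinRung`. [folklore] -/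
def HasAbsolutelyIrreducibleReduction (ρ : FramedRep Γ K n) : Prop :=
  ∃ (g : GL (Fin n) K) (s : Fin n × Fin n → Γ),
    (∀ (σ : Γ) (i j : Fin n), ‖((g * ρ σ * g⁻¹ : GL (Fin n) K) : Matrix (Fin n) (Fin n) K) i j‖ ≤ 1) ∧
      ‖(Matrix.of fun a b : Fin n × Fin n =>
          ((g * ρ (s a) * g⁻¹ : GL (Fin n) K) : Matrix (Fin n) (Fin n) K) b.1 b.2).det‖ = 1

/-! ### Unfolding and elementary API -/

/-- Unfolding of `IsResiduallyCongruent` through `FramedRep.charpoly`. [folklore] -/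
theorem isResiduallyCongruent_iff (ρ ρ₀ : FramedRep Γ K n) :
    IsResiduallyCongruent ρ ρ₀ ↔
      ∀ (σ : Γ) (i : ℕ), ‖(ρ.charpoly σ).coeff i - (ρ₀.charpoly σ).coeff i‖ < 1 :=
  Iff.rfl

/-- Residual congruence is reflexive. [folklore] -/
protected theorem IsResiduallyCongruent.refl (ρ : FramedRep Γ K n) : IsResiduallyCongruent ρ ρ :=
  fun σ i => by simp

/-- Residual congruence is symmetric. [folklore] -/
protected theorem IsResiduallyCongruent.symm {ρ ρ₀ : FramedRep Γ K n}
    (h : IsResiduallyCongruent ρ ρ₀) : IsResiduallyCongruent ρ₀ ρ :=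
  fun σ i => by rw [norm_sub_rev]; exact h σ i

/-- Over a non-archimedean normed field residual congruence is transitive (strong triangle
inequality). [folklore] -/
protected theorem IsResiduallyCongruent.trans [IsUltrametricDist K] {ρ ρ₁ ρ₂ : FramedRep Γ K n}
    (h₁ : IsResiduallyCongruent ρ ρ₁) (h₂ : IsResiduallyCongruent ρ₁ ρ₂) :
    IsResiduallyCongruent ρ ρ₂ := fun σ i => by
  have h := dist_triangle_max ((ρ.charpoly σ).coeff i) ((ρ₁.charpoly σ).coeff i)
    ((ρ₂.charpoly σ).coeff i)
  rw [dist_eq_norm, dist_eq_norm, dist_eq_norm] at h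
  exact lt_of_le_of_lt h (max_lt (h₁ σ i) (h₂ σ i))

/-- Change of frame does not change characteristic polynomials (Mathlib
`Matrix.charpoly_units_conj`; local copy of `FramedRep.charpoly_conj` of
`GlobalTriangulineSpace.lean`, not imported here to keep the import cone small). [folklore] -/
private theorem charpoly_conj_aux (P : GL (Fin n) K) (ρ : FramedRep Γ K n) (σ : Γ) :
    (ρ.conj P).charpoly σ = ρ.charpoly σ := by
  simp only [FramedRep.charpoly, FramedRep.conj_apply, Units.val_mul, Matrix.coe_units_inv]
  exact Matrix.charpoly_units_conj P _

/-- Residual congruence is invariant under a change of frame of the first argument. [folklore] -/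
@[simp] theorem isResiduallyCongruent_conj_left_iff (P : GL (Fin n) K) (ρ ρ₀ : FramedRep Γ K n) :
    IsResiduallyCongruent (ρ.conj P) ρ₀ ↔ IsResiduallyCongruent ρ ρ₀ := by
  simp only [isResiduallyCongruent_iff, charpoly_conj_aux]

/-- Residual congruence is invariant under a change of frame of the second argument. [folklore] -/
@[simp] theorem isResiduallyCongruent_conj_right_iff (P : GL (Fin n) K)
    (ρ ρ₀ : FramedRep Γ K n) :
    IsResiduallyCongruent ρ (ρ₀.conj P) ↔ IsResiduallyCongruent ρ ρ₀ := by
  simp only [isResiduallyCongruent_iff, charpoly_conj_aux]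

/-- Having absolutely irreducible reduction is invariant under a change of frame
(`g ↦ g P⁻¹`). [folklore] -/
@[simp] theorem hasAbsolutelyIrreducibleReduction_conj_iff (P : GL (Fin n) K)
    (ρ : FramedRep Γ K n) :
    (ρ.conj P).HasAbsolutelyIrreducibleReduction ↔ ρ.HasAbsolutelyIrreducibleReduction := by
  have key : ∀ (g : GL (Fin n) K) (σ : Γ), g * (ρ.conj P) σ * g⁻¹ = g * P * ρ σ * (g * P)⁻¹ :=
    fun g σ => by rw [FramedRep.conj_apply, _root_.mul_inv_rev]; group
  constructor
  · rintro ⟨g, s, hint, hdet⟩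
    refine ⟨g * P, s, fun σ i j => ?_, ?_⟩
    · rw [← key]; exact hint σ i j
    · simp_rw [← key]; exact hdet
  · rintro ⟨g, s, hint, hdet⟩
    refine ⟨g * P⁻¹, s, fun σ i j => ?_, ?_⟩
    · rw [key, inv_mul_cancel_right]; exact hint σ i j
    · simp_rw [key, inv_mul_cancel_right]; exact hdet

end Defs

end FramedRep

/-! ### The valuation ring `{‖x‖ ≤ 1}` and its maximal ideal `{‖x‖ < 1}` -/

section ValuationRing

variable {K : Type*} [NormedField K] {O : ValuationSubring K}

/-- If the valuation subring `O ⊆ K` is the closed unit ball of the norm, its maximal ideal is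
the open unit ball: for `x ∈ O`, `x ∈ 𝔪 ↔ ‖x‖ < 1` (`x ∉ 𝔪 ↔ x⁻¹ ∈ O ↔ ‖x‖ ≥ 1`). [folklore] -/
theorem mem_maximalIdeal_iff_norm_lt_one (hO : ∀ x : K, x ∈ O ↔ ‖x‖ ≤ 1) (x : O) :
    x ∈ maximalIdeal O ↔ ‖(x : K)‖ < 1 := by
  rw [IsLocalRing.mem_maximalIdeal, Submonoid.mem_nonunits_iff_or]
  constructor
  · rintro (h | h)
    · rw [h, norm_zero]; exact one_pos
    · rw [hO, not_le, norm_inv] at h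
      exact (one_lt_inv_iff₀.1 h).2
  · intro h
    by_cases hx : (x : K) = 0
    · exact Or.inl hx
    · exact Or.inr (by rw [hO, not_le, norm_inv]; exact one_lt_inv_iff₀.2 ⟨norm_pos_iff.2 hx, h⟩)

/-- With `O = {‖x‖ ≤ 1}`: an `O`-integral square matrix has determinant of norm `1` iff its
reduction modulo `𝔪` is invertible (`det` commutes with `O ⊆ K` and with `O → κ`). [folklore] -/
theorem norm_det_map_subtype_eq_one_iff (hO : ∀ x : K, x ∈ O ↔ ‖x‖ ≤ 1) {m : Type*} [Fintype m]
    [DecidableEq m] (M₀ : Matrix m m O) :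
    ‖(M₀.map O.subtype).det‖ = 1 ↔ (M₀.map (residue O)).det ≠ 0 := by
  rw [← RingHom.mapMatrix_apply, ← RingHom.map_det, ← RingHom.mapMatrix_apply, ← RingHom.map_det,
    Ne, residue_eq_zero_iff, mem_maximalIdeal_iff_norm_lt_one hO]
  have hle : ‖(M₀.det : K)‖ ≤ 1 := (hO _).1 M₀.det.2
  change ‖(M₀.det : K)‖ = 1 ↔ ¬‖(M₀.det : K)‖ < 1
  constructor
  · intro h; rw [h]; exact lt_irrefl 1
  · intro h; exact le_antisymm hle (not_lt.1 h)

/-- For `ℚ̄_p = PadicAlgCl p` (Mathlib), the valuation ring `Valued.v.valuationSubring` of its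
canonical rank-one valuation is the closed unit ball of the `p`-adic norm, so the lemmas of this
file apply with `O = Valued.v.valuationSubring`. [folklore] -/
theorem padicAlgCl_mem_valuationSubring_iff (p : ℕ) [Fact p.Prime] (x : PadicAlgCl p) :
    x ∈ (Valued.v (R := PadicAlgCl p)).valuationSubring ↔ ‖x‖ ≤ 1 := by
  rw [Valuation.mem_valuationSubring_iff, PadicAlgCl.valuation_def, ← NNReal.coe_le_coe,
    coe_nnnorm, NNReal.coe_one]

end ValuationRing

/-! ### Residual congruence and reductions of integral models -/

namespace FramedRep

section Bridge

variable {Γ : Type*} [Group Γ] [TopologicalSpace Γ] {K : Type*} [NormedField K]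
  {O : ValuationSubring K} {n : ℕ}

/-- Entries of an integral model: if `GL_n(O) ∋ ρ₀ σ ↦ A ∈ GL_n(K)` then `Aᵢⱼ = (ρ₀ σ)ᵢⱼ`. [folklore] -/
lemma coe_apply_eq_of_map_eq {A : GL (Fin n) K} {B : GL (Fin n) O}
    (h : Matrix.GeneralLinearGroup.map O.subtype B = A) (i j : Fin n) :
    (A : Matrix (Fin n) (Fin n) K) i j = (((B : GL (Fin n) O) : Matrix (Fin n) (Fin n) O) i j : K) := by
  rw [← h]; rfl

/-- **Residual congruence = equality of the characteristic polynomials of the reductions.**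
Let `O = {‖x‖ ≤ 1} ⊆ K` with residue field `κ`, and let `ρ₀, ρ₀' : Γ → GL_n(O)` be integral
models of `ρ, ρ' : Γ → GL_n(K)` in some frames (`ρ₀ = P⁻¹ ρ P`, `ρ₀' = P'⁻¹ ρ' P'`, as provided
by `exists_integralModel` for compact `Γ`). Then `ρ, ρ'` are residually congruent iff the
reductions `ρ̄₀, ρ̄₀' : Γ → GL_n(κ)` have the same characteristic polynomials — by Brauer–Nesbitt,
iff `ρ̄₀ˢˢ ≅ ρ̄₀'ˢˢ`. (Serre, *Abelian ℓ-adic representations*, I.2.3.) [folklore] -/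
theorem isResiduallyCongruent_iff_charpoly_residualRep_eq (hO : ∀ x : K, x ∈ O ↔ ‖x‖ ≤ 1)
    {ρ ρ' : FramedRep Γ K n} {P P' : GL (Fin n) K} {ρ₀ ρ₀' : Γ →* GL (Fin n) O}
    (h : ∀ σ, Matrix.GeneralLinearGroup.map O.subtype (ρ₀ σ) = P⁻¹ * ρ σ * P)
    (h' : ∀ σ, Matrix.GeneralLinearGroup.map O.subtype (ρ₀' σ) = P'⁻¹ * ρ' σ * P') :
    IsResiduallyCongruent ρ ρ' ↔ ∀ σ,
      (((Matrix.GeneralLinearGroup.map (residue O)).comp ρ₀ σ : GL (Fin n) (ResidueField O)) :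
          Matrix (Fin n) (Fin n) (ResidueField O)).charpoly =
        (((Matrix.GeneralLinearGroup.map (residue O)).comp ρ₀' σ : GL (Fin n) (ResidueField O)) :
          Matrix (Fin n) (Fin n) (ResidueField O)).charpoly := by
  refine forall_congr' fun σ => ?_
  rw [charpoly_residualRep, charpoly_residualRep, Polynomial.ext_iff]
  refine forall_congr' fun i => ?_
  rw [Polynomial.coeff_map, Polynomial.coeff_map, ← sub_eq_zero, ← map_sub, residue_eq_zero_iff,
    mem_maximalIdeal_iff_norm_lt_one hO]
  have hc := charpoly_integralModel (ρ := ρ.toMonoidHom) h σ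
  have hc' := charpoly_integralModel (ρ := ρ'.toMonoidHom) h' σ
  change ‖(FramedRep.charpoly ρ σ).coeff i - (FramedRep.charpoly ρ' σ).coeff i‖ < 1 ↔ _
  rw [FramedRep.charpoly, FramedRep.charpoly]
  change ‖((ρ.toMonoidHom σ : GL (Fin n) K) : Matrix (Fin n) (Fin n) K).charpoly.coeff i -
    ((ρ'.toMonoidHom σ : GL (Fin n) K) : Matrix (Fin n) (Fin n) K).charpoly.coeff i‖ < 1 ↔ _
  rw [← hc, ← hc', Polynomial.coeff_map, Polynomial.coeff_map]
  rfl

/-! ### Burnside form and the span of the residual image -/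

/-- The flattening `M_n(κ) ≃ κ^{n × n}`, `A ↦ (b ↦ A b.1 b.2)`. [folklore] -/
def flattenMatrix (R : Type*) [CommSemiring R] (n : ℕ) :
    Matrix (Fin n) (Fin n) R ≃ₗ[R] (Fin n × Fin n → R) :=
  (Matrix.ofLinearEquiv R).symm.trans (LinearEquiv.curry R R (Fin n) (Fin n)).symm

/-- Unfolding of `flattenMatrix`. [folklore] -/
@[simp] lemma flattenMatrix_apply {R : Type*} [CommSemiring R] (A : Matrix (Fin n) (Fin n) R)
    (b : Fin n × Fin n) : flattenMatrix R n A b = A b.1 b.2 := rfl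

/-- Core of the Burnside form: for a family of matrices `X a ∈ M_n(κ)`, `a ∈ n × n`, over a field,
the `n² × n²` matrix of their entries is invertible iff the `X a` span `M_n(κ)`. [folklore] -/
theorem isUnit_of_entries_iff_span_eq_top {κ : Type*} [Field κ]
    (X : Fin n × Fin n → Matrix (Fin n) (Fin n) κ) :
    IsUnit (Matrix.of fun a b : Fin n × Fin n => X a b.1 b.2) ↔
      Submodule.span κ (Set.range X) = ⊤ := by
  set N : Matrix (Fin n × Fin n) (Fin n × Fin n) κ := Matrix.of fun a b => X a b.1 b.2 with hN
  have hrow : N.row = flattenMatrix κ n ∘ X := by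
    funext a; ext b; rfl
  have hinj : Function.Injective (flattenMatrix κ n) := (flattenMatrix κ n).injective
  constructor
  · intro hU
    have hsurj : Function.Surjective N.vecMul := Matrix.vecMul_surjective_iff_isUnit.2 hU
    have hr : Submodule.span κ (Set.range N.row) = ⊤ := by
      rw [← range_vecMulLinear]
      exact LinearMap.range_eq_top.2 hsurj
    rw [hrow, Set.range_comp] at hr
    refine Submodule.eq_top_iff'.2 fun A => ?_
    have hA : flattenMatrix κ n A ∈ Submodule.span κ (flattenMatrix κ n '' Set.range X) := by
      rw [hr]; exact Submodule.mem_top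
    exact (Submodule.apply_mem_span_image_iff_mem_span (f := (flattenMatrix κ n).toLinearMap)
      hinj).1 hA
  · intro hspan
    -- the rows of `N` span `κ^{n × n}`, hence `vecMul` is onto
    refine Matrix.vecMul_surjective_iff_isUnit.1 fun v => ?_
    have hv : v ∈ LinearMap.range N.vecMulLinear := by
      rw [range_vecMulLinear, hrow, Set.range_comp]
      have hA : (flattenMatrix κ n).symm v ∈ Submodule.span κ (Set.range X) := by
        rw [hspan]; exact Submodule.mem_top
      have := (Submodule.apply_mem_span_image_iff_mem_span
        (f := (flattenMatrix κ n).toLinearMap) hinj).2 hA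
      simpa using this
    exact hv

/-- **Burnside form ⟺ the residual image of an integral model spans `M_n(κ)`.** Let
`O = {‖x‖ ≤ 1} ⊆ K` with residue field `κ`. A framed representation `ρ : Γ → GL_n(K)` has
absolutely irreducible reduction in the Burnside form iff it admits an integral model
`ρ₀ : Γ → GL_n(O)` in some frame (`ρ₀ = P⁻¹ ρ P`) whose reduction `ρ̄₀ : Γ → GL_n(κ)` has image
spanning `M_n(κ)` over `κ`: the frame is `g = P⁻¹`, the `O`-span of `ρ₀(Γ)` reduces onto the
`κ`-span of `ρ̄₀(Γ)`, and `n²` reduced matrices form a basis of `M_n(κ)` iff the `n² × n²` matrix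
of their entries — the reduction of the integral matrix in the definition — is invertible, i.e.
iff that integral matrix has unit determinant. For `n ≥ 1` and `κ` algebraically closed,
spanning `M_n(κ)` is Burnside's criterion for (absolute) irreducibility of `ρ̄₀`
(Curtis–Reiner (27.4)). [folklore] -/
theorem hasAbsolutelyIrreducibleReduction_iff_exists_span_eq_top
    (hO : ∀ x : K, x ∈ O ↔ ‖x‖ ≤ 1) (ρ : FramedRep Γ K n) :
    ρ.HasAbsolutelyIrreducibleReduction ↔
      ∃ (P : GL (Fin n) K) (ρ₀ : Γ →* GL (Fin n) O),
        (∀ σ, Matrix.GeneralLinearGroup.map O.subtype (ρ₀ σ) = P⁻¹ * ρ σ * P) ∧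
          Submodule.span (ResidueField O)
            (Set.range fun σ => (((Matrix.GeneralLinearGroup.map (residue O)).comp ρ₀ σ :
              GL (Fin n) (ResidueField O)) : Matrix (Fin n) (Fin n) (ResidueField O))) = ⊤ := by
  classical
  -- common computation: for an integral model `ρ₀` in the frame `g` and `s : n × n → Γ`, the
  -- matrix of the definition is the image of an `O`-matrix whose reduction is the matrix of
  -- entries of the reduced family `a ↦ ρ̄₀ (s a)`
  have key : ∀ (g : GL (Fin n) K) (ρ₀ : Γ →* GL (Fin n) O)
      (_ : ∀ σ, Matrix.GeneralLinearGroup.map O.subtype (ρ₀ σ) = g * ρ σ * g⁻¹)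
      (s : Fin n × Fin n → Γ),
      (‖(Matrix.of fun a b : Fin n × Fin n =>
          ((g * ρ (s a) * g⁻¹ : GL (Fin n) K) : Matrix (Fin n) (Fin n) K) b.1 b.2).det‖ = 1 ↔
        IsUnit (Matrix.of fun a b : Fin n × Fin n =>
          ((((Matrix.GeneralLinearGroup.map (residue O)).comp ρ₀ (s a) :
            GL (Fin n) (ResidueField O)) : Matrix (Fin n) (Fin n) (ResidueField O))) b.1 b.2)) := by
    intro g ρ₀ hρ₀ s
    set M₀ : Matrix (Fin n × Fin n) (Fin n × Fin n) O :=
      Matrix.of fun a b => ((ρ₀ (s a) : GL (Fin n) O) : Matrix (Fin n) (Fin n) O) b.1 b.2 with hM₀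
    have h1 : (Matrix.of fun a b : Fin n × Fin n =>
        ((g * ρ (s a) * g⁻¹ : GL (Fin n) K) : Matrix (Fin n) (Fin n) K) b.1 b.2) =
          M₀.map O.subtype := by
      ext a b
      rw [Matrix.of_apply, coe_apply_eq_of_map_eq (hρ₀ (s a))]
      rfl
    have h2 : (Matrix.of fun a b : Fin n × Fin n =>
        ((((Matrix.GeneralLinearGroup.map (residue O)).comp ρ₀ (s a) :
          GL (Fin n) (ResidueField O)) : Matrix (Fin n) (Fin n) (ResidueField O))) b.1 b.2) =
          M₀.map (residue O) := by
      ext a b; rfl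
    rw [h1, h2, norm_det_map_subtype_eq_one_iff hO, Matrix.isUnit_iff_isUnit_det, isUnit_iff_ne_zero]
  constructor
  · rintro ⟨g, s, hint, hdet⟩
    -- the integral model in the frame `g`
    let φ : Γ →* GL (Fin n) K := (MulAut.conj g).toMonoidHom.comp ρ.toMonoidHom
    have hφ : ∀ σ, φ σ = g * ρ σ * g⁻¹ := fun σ => by simp [φ]
    have hmem : ∀ σ, φ σ ∈ (Matrix.GeneralLinearGroup.map (n := Fin n) O.subtype).range := by
      intro σ
      rw [mem_range_generalLinearGroup_map_iff, hφ]
      refine ⟨fun i j => (hO _).2 (hint σ i j), fun i j => (hO _).2 ?_⟩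
      have hinv : (g * ρ σ * g⁻¹)⁻¹ = g * ρ σ⁻¹ * g⁻¹ := by rw [map_inv]; group
      rw [hinv]
      exact hint σ⁻¹ i j
    obtain ⟨ρ₀, hρ₀⟩ := exists_monoidHom_map_eq φ hmem
    have hρ₀' : ∀ σ, Matrix.GeneralLinearGroup.map O.subtype (ρ₀ σ) = g * ρ σ * g⁻¹ :=
      fun σ => (hρ₀ σ).trans (hφ σ)
    refine ⟨g⁻¹, ρ₀, fun σ => by rw [hρ₀', inv_inv], ?_⟩
    -- the `n²` reduced matrices `ρ̄₀ (s a)` span, a fortiori the whole residual image does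
    have hU := (key g ρ₀ hρ₀' s).1 hdet
    rw [isUnit_of_entries_iff_span_eq_top] at hU
    refine eq_top_iff.2 (hU ▸ Submodule.span_mono ?_)
    rintro _ ⟨a, rfl⟩
    exact ⟨s a, rfl⟩
  · rintro ⟨P, ρ₀, hρ₀, hspan⟩
    have hρ₀' : ∀ σ, Matrix.GeneralLinearGroup.map O.subtype (ρ₀ σ) = P⁻¹ * ρ σ * P⁻¹⁻¹ :=
      fun σ => by rw [hρ₀, inv_inv]
    -- extract from the spanning residual image a basis of `M_n(κ)`, indexed by `n × n`
    set X : Γ → Matrix (Fin n) (Fin n) (ResidueField O) := fun σ =>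
      (((Matrix.GeneralLinearGroup.map (residue O)).comp ρ₀ σ : GL (Fin n) (ResidueField O)) :
        Matrix (Fin n) (Fin n) (ResidueField O)) with hX
    obtain ⟨T, a, -, hspan', hli⟩ := exists_linearIndependent' (K := ResidueField O) X
    rw [hspan] at hspan'
    let b : Module.Basis T (ResidueField O) (Matrix (Fin n) (Fin n) (ResidueField O)) :=
      Module.Basis.mk hli hspan'.ge
    letI : Fintype T := FiniteDimensional.fintypeBasisIndex b
    have hcard : Fintype.card (Fin n × Fin n) = Fintype.card T := by
      rw [← Module.finrank_eq_card_basis b, Module.finrank_matrix, Module.finrank_self,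
        Fintype.card_prod]
      ring
    let e : Fin n × Fin n ≃ T := Fintype.equivOfCardEq hcard
    refine ⟨P⁻¹, fun c => a (e c), fun σ i j => ?_, ?_⟩
    · rw [coe_apply_eq_of_map_eq (hρ₀' σ)]
      exact (hO _).1 (SetLike.coe_mem _)
    · rw [key P⁻¹ ρ₀ hρ₀' (fun c => a (e c)), isUnit_of_entries_iff_span_eq_top]
      have hli' : LinearIndependent (ResidueField O) (fun c => X (a (e c))) :=
        hli.comp e e.injective
      exact hli'.span_eq_top_of_card_eq_finrank' (hcard.trans (Module.finrank_eq_card_basis b).symm)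

end Bridge

end FramedRep

end Literature.NumberTheory.GaloisRepresentations
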